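import Summits.NavierStokesRegularity.NavierStokesRegularity.Theorems.TypeICertificateLadderTargetDepletionLambPairing
import Literature.Analysis.FluidPDE.CheskidovAssemblyTools
import HarnessLib

/-!
# Crux `Target` = `TypeICertificateLadder.NoTypeIBlowup` (stmt-NavierStokesRegularity-1217), line
# `depletion-ladder`, stub S1 `stub_depletionBelowHalf`: the ALIGNMENT DEFECT of the depletion functional

`--supports stmt-NavierStokesRegularity-1217` (line `depletion-ladder`, skeleton
`Cruxes/Target/Lines/depletion_ladder.lean`; route (ii) of the line's S1 census — "the no-saturation
identity made quantitative": STRUCTURE OF NEAR-EXTREMISERS — on the EXACT class of the line's definition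
`DepletionLadder.StretchingDepletion`: `u ∈ C²` divergence-free, `|u| ≤ M`, `ω = curl u ∈ L²`,
`|∇ω|_F ∈ L²`, integrable stretching density; NO decay of `u`, NO energy).

S1 asks for `κ < 1/2` in `|∫⟪ω, Du ω⟫| ≤ κ · M · ‖ω‖₂ · ‖∇ω‖₂`; the Cauchy–Schwarz member `κ = 1` is the
landed `stretchingDepletion_one`, and by the companion file `…TargetDepletionLambPairing.lean`
(`integral_stretching_eq_integral_inner_cross`) the functional is the vorticity–Lamb pairing
`∫⟪ω, Du ω⟫ = ∫⟪u, ω × curl ω⟫` on this class. This file identifies WHERE the Cauchy–Schwarz slack lives: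

* `inner_cross_sq_le` — the pointwise Lagrange bound `⟪u, a × c⟫² ≤ ‖a‖²(‖u‖²‖c‖² − ⟪u, c⟫²)`
  (`= ‖a‖²‖c × u‖²`; the difference is `‖a × (c × u)‖²`), with its amplitude form
  (`inner_cross_sq_le_of_norm_le`, `‖u‖ ≤ M`) and direction form (`inner_cross_sq_le_direction`).
* `sq_integral_stretching_le_defect` — with `c = curl ω`:
  `(∫⟪ω, Du ω⟫)² ≤ ‖ω‖₂² · (M²‖curl ω‖₂² − ‖⟪u, curl ω⟫‖₂²)`:
  the ONLY slack in the Cauchy–Schwarz constant is the `L²`-mass of the velocity–palinstrophy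
  alignment `⟪u, curl ω⟫` (saturation needs `u ⊥ curl ω` in `L²`-mean).
* `sq_integral_stretching_le_direction_defect` — the sharper direction form
  `(∫⟪ω, Du ω⟫)² ≤ M²‖ω‖₂²(‖curl ω‖₂² − ∫⟪u, curl ω⟫²/‖u‖²)`: the aligned palinstrophy fraction
  `A = ∫(⟪u, curl ω⟫²/‖u‖²)/‖curl ω‖₂²` is pure slack — `R² + A ≤ 1` after normalisation (the
  normalisation `‖curl ω‖₂ = ‖∇ω‖₂` for `u ∈ C³`, the alignment identity `∫⟪u, curl ω⟫ = ‖ω‖₂²` and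
  `A ≥ Q` are in `…TargetDepletionAlignmentIdentity.lean`).

Numerical footnote (kit jobs of this seat, `--workitem 1217`): on the band-limited maximisers of `R`
found by gradient ascent (`R ≈ 0.14`), `A ≈ 0.8` — the maximisers are far from the saturation geometry
`A → 0`; they trade alignment for amplitude. WHAT THIS IS NOT: not a bound `κ̂ < 1` (no lower bound on
`A` is proved on the class); kernel-checked structural constraints on near-extremisers. Elementary.
[folklore]

References: Constantin, Comm. Math. Phys. 129 (1990) 241–266 (stretching in Lamb variables); Lu–Doering,
Indiana Univ. Math. J. 57 (2008) 2693–2727 (enstrophy-production extremals); Majda–Bertozzi 2002, §2.1.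
-/

noncomputable section

open Set Function Filter Topology MeasureTheory
open scoped RealInnerProductSpace ENNReal NNReal ContDiff
open Literature.Analysis.FluidPDE

namespace Summit.NavierStokesRegularity.NavierStokesRegularity.Theorems.DepletionLadder

-- the problem directory repeats the summit name (`NavierStokesRegularity/NavierStokesRegularity`)
set_option linter.dupNamespace false


/-! ## Pointwise Lagrange bounds in `ℝ³` -/

/-- **Lagrange bound for the triple product.** `⟪u, a × c⟫² ≤ ‖a‖² (‖u‖²‖c‖² − ⟪u, c⟫²)`; the
right side is `‖a‖²‖c × u‖²` and the difference is `‖a × (c × u)‖² ≥ 0`. [folklore] -/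
theorem inner_cross_sq_le (u a c : EuclideanSpace ℝ (Fin 3)) :
    ⟪u, cross a c⟫ ^ 2 ≤ ‖a‖ ^ 2 * (‖u‖ ^ 2 * ‖c‖ ^ 2 - ⟪u, c⟫ ^ 2) := by
  have h3 : ∀ p q : EuclideanSpace ℝ (Fin 3), ⟪p, q⟫ = p 0 * q 0 + p 1 * q 1 + p 2 * q 2 := fun p q => by
    simp [PiLp.inner_apply, Fin.sum_univ_three, mul_comm]
  rw [← real_inner_self_eq_norm_sq a, ← real_inner_self_eq_norm_sq u, ← real_inner_self_eq_norm_sq c,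
    inner_cross_eq, h3, h3, h3, h3]
  -- `w = c × u`; the defect is `‖a × w‖²`
  set w0 := c 1 * u 2 - c 2 * u 1 with hw0
  set w1 := c 2 * u 0 - c 0 * u 2 with hw1
  set w2 := c 0 * u 1 - c 1 * u 0 with hw2
  have key : (a 0 * a 0 + a 1 * a 1 + a 2 * a 2) *
        ((u 0 * u 0 + u 1 * u 1 + u 2 * u 2) * (c 0 * c 0 + c 1 * c 1 + c 2 * c 2) -
          (u 0 * c 0 + u 1 * c 1 + u 2 * c 2) ^ 2) -
      (u 0 * (a 1 * c 2 - a 2 * c 1) + u 1 * (a 2 * c 0 - a 0 * c 2) + u 2 * (a 0 * c 1 - a 1 * c 0)) ^ 2 =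
      (a 1 * w2 - a 2 * w1) ^ 2 + (a 2 * w0 - a 0 * w2) ^ 2 + (a 0 * w1 - a 1 * w0) ^ 2 := by
    rw [hw0, hw1, hw2]; ring
  nlinarith [key, sq_nonneg (a 1 * w2 - a 2 * w1), sq_nonneg (a 2 * w0 - a 0 * w2),
    sq_nonneg (a 0 * w1 - a 1 * w0)]

/-- The Lagrange bound with an amplitude bound `‖u‖ ≤ M`:
`⟪u, a × c⟫² ≤ ‖a‖² (M²‖c‖² − ⟪u, c⟫²)`, and the bracket is nonnegative. [folklore] -/
theorem inner_cross_sq_le_of_norm_le {u a c : EuclideanSpace ℝ (Fin 3)} {M : ℝ} (hM : ‖u‖ ≤ M) :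
    0 ≤ M ^ 2 * ‖c‖ ^ 2 - ⟪u, c⟫ ^ 2 ∧
      ⟪u, cross a c⟫ ^ 2 ≤ ‖a‖ ^ 2 * (M ^ 2 * ‖c‖ ^ 2 - ⟪u, c⟫ ^ 2) := by
  have hM0 : 0 ≤ M := (norm_nonneg u).trans hM
  have h1 : ‖u‖ ^ 2 * ‖c‖ ^ 2 ≤ M ^ 2 * ‖c‖ ^ 2 :=
    mul_le_mul_of_nonneg_right (pow_le_pow_left₀ (norm_nonneg _) hM 2) (sq_nonneg _)
  have h2 : ⟪u, c⟫ ^ 2 ≤ ‖u‖ ^ 2 * ‖c‖ ^ 2 := by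
    rw [← mul_pow]; exact sq_le_sq' (by linarith [abs_real_inner_le_norm u c, abs_le.1 (abs_real_inner_le_norm u c) |>.1])
      (real_inner_le_norm u c)
  refine ⟨by linarith, (inner_cross_sq_le u a c).trans ?_⟩
  exact mul_le_mul_of_nonneg_left (by linarith) (sq_nonneg _)

/-- Direction form of the Lagrange bound: `⟪u, a × c⟫² ≤ M²‖a‖²(‖c‖² − ⟪u, c⟫²/‖u‖²)` for
`‖u‖ ≤ M` (`x/0 = 0`), and `⟪u,c⟫²/‖u‖² ≤ ‖c‖²`. [folklore] -/
theorem inner_cross_sq_le_direction {u a c : EuclideanSpace ℝ (Fin 3)} {M : ℝ} (hM : ‖u‖ ≤ M) :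
    ⟪u, c⟫ ^ 2 / ‖u‖ ^ 2 ≤ ‖c‖ ^ 2 ∧
      ⟪u, cross a c⟫ ^ 2 ≤ M ^ 2 * ‖a‖ ^ 2 * (‖c‖ ^ 2 - ⟪u, c⟫ ^ 2 / ‖u‖ ^ 2) := by
  have h2 : ⟪u, c⟫ ^ 2 ≤ ‖u‖ ^ 2 * ‖c‖ ^ 2 := by
    rw [← mul_pow]; exact sq_le_sq' (by linarith [abs_le.1 (abs_real_inner_le_norm u c) |>.1])
      (real_inner_le_norm u c)
  rcases eq_or_lt_of_le (norm_nonneg u) with hu0 | hupos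
  · -- `u = 0`
    have hu : u = 0 := norm_eq_zero.1 hu0.symm
    subst hu
    refine ⟨by simp, ?_⟩
    have : (⟪(0 : EuclideanSpace ℝ (Fin 3)), cross a c⟫ : ℝ) = 0 := inner_zero_left _
    rw [this]
    simp only [inner_zero_left, ne_eq, OfNat.ofNat_ne_zero, not_false_eq_true, zero_pow, norm_zero,
      div_zero, sub_zero]
    positivity
  have hu2 : 0 < ‖u‖ ^ 2 := by positivity
  have hdiv : ⟪u, c⟫ ^ 2 / ‖u‖ ^ 2 ≤ ‖c‖ ^ 2 := by
    rw [div_le_iff₀ hu2]; linarith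
  refine ⟨hdiv, ?_⟩
  have hL := inner_cross_sq_le u a c
  -- `‖a‖²(‖u‖²‖c‖² − ⟪u,c⟫²) = ‖a‖² ‖u‖² (‖c‖² − ⟪u,c⟫²/‖u‖²) ≤ ‖a‖² M² (…)`
  have heq : ‖u‖ ^ 2 * ‖c‖ ^ 2 - ⟪u, c⟫ ^ 2 = ‖u‖ ^ 2 * (‖c‖ ^ 2 - ⟪u, c⟫ ^ 2 / ‖u‖ ^ 2) := by
    field_simp
  rw [heq] at hL
  have hM0 : 0 ≤ M := (norm_nonneg u).trans hM
  have hnn : 0 ≤ ‖c‖ ^ 2 - ⟪u, c⟫ ^ 2 / ‖u‖ ^ 2 := sub_nonneg.2 hdiv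
  calc ⟪u, cross a c⟫ ^ 2 ≤ ‖a‖ ^ 2 * (‖u‖ ^ 2 * (‖c‖ ^ 2 - ⟪u, c⟫ ^ 2 / ‖u‖ ^ 2)) := hL
    _ ≤ ‖a‖ ^ 2 * (M ^ 2 * (‖c‖ ^ 2 - ⟪u, c⟫ ^ 2 / ‖u‖ ^ 2)) := by
        gcongr
    _ = M ^ 2 * ‖a‖ ^ 2 * (‖c‖ ^ 2 - ⟪u, c⟫ ^ 2 / ‖u‖ ^ 2) := by ring

section Class

variable {u : EuclideanSpace ℝ (Fin 3) → EuclideanSpace ℝ (Fin 3)} {M : ℝ}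

/-! ## The alignment defect -/

/-- `⟪u, curl curl u⟫²` is integrable on the class (`≤ M²‖curl curl u‖²`). [folklore] -/
theorem integrable_inner_curl_curl_sq (hu : ContDiff ℝ 2 u) (hM : ∀ x, ‖u x‖ ≤ M)
    (iA : Integrable (fun x => frobeniusNormSq (fderiv ℝ (curl u) x))) :
    Integrable (fun x => ⟪u x, curl (curl u) x⟫ ^ 2) := by
  have cc : Continuous (curl (curl u)) := continuous_curl (contDiff_one_curl_of_contDiff_two hu)
  refine ((integrable_norm_curl_curl_sq hu iA).const_mul (M ^ 2)).mono'
    ((hu.continuous.inner cc).pow 2).aestronglyMeasurable (Eventually.of_forall fun x => ?_)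
  rw [Real.norm_of_nonneg (sq_nonneg _)]
  have h2 : ⟪u x, curl (curl u) x⟫ ^ 2 ≤ ‖u x‖ ^ 2 * ‖curl (curl u) x‖ ^ 2 := by
    rw [← mul_pow]
    exact sq_le_sq' (by linarith [abs_le.1 (abs_real_inner_le_norm (u x) (curl (curl u) x)) |>.1])
      (real_inner_le_norm _ _)
  exact h2.trans (mul_le_mul_of_nonneg_right (pow_le_pow_left₀ (norm_nonneg _) (hM x) 2) (sq_nonneg _))

/-- **The alignment-defect inequality** (Lamb variables). On the class of
`DepletionLadder.StretchingDepletion` (`u ∈ C²` divergence-free, `|u| ≤ M`, `ω = curl u ∈ L²`,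
`|∇ω|_F ∈ L²`, integrable stretching density):
`(∫⟪ω, Du ω⟫)² ≤ ‖ω‖₂² · (M² ‖curl ω‖₂² − ‖⟪u, curl ω⟫‖₂²)`.
The Cauchy–Schwarz value `M²‖ω‖₂²‖curl ω‖₂²` is diminished by EXACTLY the `L²`-mass of the
velocity–palinstrophy alignment `⟪u, curl ω⟫`: saturation requires `u ⊥ curl ω`. Proof: the Lamb
pairing form of the stretching integral, the pointwise Lagrange bound
`⟪u, ω × c⟫² ≤ ‖ω‖²(M²‖c‖² − ⟪u, c⟫²)`, and Cauchy–Schwarz in `L²`. [folklore] -/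
theorem sq_integral_stretching_le_defect (hu : ContDiff ℝ 2 u)
    (hdiv : VectorCalculus.IsDivFree u) (hM : ∀ x, ‖u x‖ ≤ M)
    (iZ : Integrable (fun x => ‖curl u x‖ ^ 2))
    (iA : Integrable (fun x => frobeniusNormSq (fderiv ℝ (curl u) x)))
    (iJ : Integrable (fun x => ⟪curl u x, fderiv ℝ u x (curl u x)⟫)) :
    (∫ x, ⟪curl u x, fderiv ℝ u x (curl u x)⟫) ^ 2 ≤
      (∫ x, ‖curl u x‖ ^ 2) *
        (M ^ 2 * (∫ x, ‖curl (curl u) x‖ ^ 2) - ∫ x, ⟪u x, curl (curl u) x⟫ ^ 2) := by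
  rw [integral_stretching_eq_integral_inner_cross hu hdiv hM iZ iA iJ]
  have cω : Continuous (curl u) := continuous_curl (hu.of_le (by norm_num))
  have cc : Continuous (curl (curl u)) := continuous_curl (contDiff_one_curl_of_contDiff_two hu)
  -- the defect density and the pointwise bound
  set dfn : EuclideanSpace ℝ (Fin 3) → ℝ :=
    fun x => M ^ 2 * ‖curl (curl u) x‖ ^ 2 - ⟪u x, curl (curl u) x⟫ ^ 2 with hdfn
  have hdfn0 : ∀ x, 0 ≤ dfn x := fun x =>
    (inner_cross_sq_le_of_norm_le (a := curl u x) (c := curl (curl u) x) (hM x)).1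
  have hpt : ∀ x, |⟪u x, cross (curl u x) (curl (curl u) x)⟫| ≤ ‖curl u x‖ * Real.sqrt (dfn x) := by
    intro x
    have h := (inner_cross_sq_le_of_norm_le (a := curl u x) (c := curl (curl u) x) (hM x)).2
    rw [← Real.sqrt_sq (abs_nonneg _), ← Real.sqrt_sq (norm_nonneg (curl u x)),
      ← Real.sqrt_mul (sq_nonneg _)]
    exact Real.sqrt_le_sqrt (by rw [sq_abs]; exact h)
  -- integrability and `L²` membership
  have iW : Integrable (fun x => ‖curl (curl u) x‖ ^ 2) := integrable_norm_curl_curl_sq hu iA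
  have iuc : Integrable (fun x => ⟪u x, curl (curl u) x⟫ ^ 2) := integrable_inner_curl_curl_sq hu hM iA
  have idfn : Integrable dfn := (iW.const_mul _).sub iuc
  have hD : ∫ x, dfn x = M ^ 2 * (∫ x, ‖curl (curl u) x‖ ^ 2) - ∫ x, ⟪u x, curl (curl u) x⟫ ^ 2 := by
    simp only [hdfn]
    rw [integral_sub (iW.const_mul _) iuc, integral_const_mul]
  have cdfn : Continuous dfn := (continuous_const.mul (cc.norm.pow 2)).sub ((hu.continuous.inner cc).pow 2)
  have mω : MemLp (fun x => ‖curl u x‖) 2 volume := memLp_two_norm_curl hu iZ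
  have msq : MemLp (fun x => Real.sqrt (dfn x)) 2 volume := by
    refine (memLp_two_iff_integrable_sq (cdfn.sqrt).aestronglyMeasurable).2 ?_
    exact idfn.congr (Eventually.of_forall fun x => (Real.sq_sqrt (hdfn0 x)).symm)
  have iI : Integrable (fun x => ⟪u x, cross (curl u x) (curl (curl u) x)⟫) :=
    integrable_inner_cross_curl hu hM iZ iA
  -- Cauchy–Schwarz chain
  have h1 : |∫ x, ⟪u x, cross (curl u x) (curl (curl u) x)⟫| ≤
      ∫ x, ‖curl u x‖ * Real.sqrt (dfn x) :=
    (abs_integral_le_integral_abs).trans (integral_mono iI.abs (mω.integrable_mul msq) hpt)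
  have h2 : ∫ x, ‖curl u x‖ * Real.sqrt (dfn x) ≤
      Real.sqrt (∫ x, ‖curl u x‖ ^ 2) * Real.sqrt (∫ x, Real.sqrt (dfn x) ^ 2) :=
    integral_mul_le_sqrt_mul_sqrt_of_memLp mω msq
  have hsq : ∫ x, Real.sqrt (dfn x) ^ 2 = ∫ x, dfn x :=
    integral_congr_ae (Eventually.of_forall fun x => Real.sq_sqrt (hdfn0 x))
  rw [hsq] at h2
  have hZ0 : 0 ≤ ∫ x, ‖curl u x‖ ^ 2 := integral_nonneg fun x => sq_nonneg _
  have hD0 : 0 ≤ ∫ x, dfn x := integral_nonneg hdfn0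
  rw [← hD]
  calc (∫ x, ⟪u x, cross (curl u x) (curl (curl u) x)⟫) ^ 2
      = |∫ x, ⟪u x, cross (curl u x) (curl (curl u) x)⟫| ^ 2 := (sq_abs _).symm
    _ ≤ (Real.sqrt (∫ x, ‖curl u x‖ ^ 2) * Real.sqrt (∫ x, dfn x)) ^ 2 :=
        pow_le_pow_left₀ (abs_nonneg _) (h1.trans h2) 2
    _ = (∫ x, ‖curl u x‖ ^ 2) * ∫ x, dfn x := by
        rw [mul_pow, Real.sq_sqrt hZ0, Real.sq_sqrt hD0]

/-- **Direction form of the alignment defect.** Same class: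
`(∫⟪ω, Du ω⟫)² ≤ M² ‖ω‖₂² (‖curl ω‖₂² − ∫ ⟪u, curl ω⟫²/‖u‖²)` (`x/0 = 0`): the aligned
palinstrophy fraction `A = ∫(⟪u, curl ω⟫²/‖u‖²)/‖curl ω‖₂²` is pure slack, `R² + A ≤ 1` after
normalisation. Sharper than the previous form since `⟪u,c⟫²/‖u‖² ≥ ⟪u,c⟫²/M²`. [folklore] -/
theorem sq_integral_stretching_le_direction_defect (hu : ContDiff ℝ 2 u)
    (hdiv : VectorCalculus.IsDivFree u) (hM : ∀ x, ‖u x‖ ≤ M)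
    (iZ : Integrable (fun x => ‖curl u x‖ ^ 2))
    (iA : Integrable (fun x => frobeniusNormSq (fderiv ℝ (curl u) x)))
    (iJ : Integrable (fun x => ⟪curl u x, fderiv ℝ u x (curl u x)⟫)) :
    (∫ x, ⟪curl u x, fderiv ℝ u x (curl u x)⟫) ^ 2 ≤
      M ^ 2 * (∫ x, ‖curl u x‖ ^ 2) *
        ((∫ x, ‖curl (curl u) x‖ ^ 2) - ∫ x, ⟪u x, curl (curl u) x⟫ ^ 2 / ‖u x‖ ^ 2) := by
  rw [integral_stretching_eq_integral_inner_cross hu hdiv hM iZ iA iJ]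
  have hM0 : 0 ≤ M := (norm_nonneg _).trans (hM 0)
  have cω : Continuous (curl u) := continuous_curl (hu.of_le (by norm_num))
  have cc : Continuous (curl (curl u)) := continuous_curl (contDiff_one_curl_of_contDiff_two hu)
  set al : EuclideanSpace ℝ (Fin 3) → ℝ := fun x => ⟪u x, curl (curl u) x⟫ ^ 2 / ‖u x‖ ^ 2 with hal
  set dfn : EuclideanSpace ℝ (Fin 3) → ℝ := fun x => ‖curl (curl u) x‖ ^ 2 - al x with hdfn
  have hal0 : ∀ x, 0 ≤ al x := fun x => by positivity
  have hal1 : ∀ x, al x ≤ ‖curl (curl u) x‖ ^ 2 := fun x =>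
    (inner_cross_sq_le_direction (a := curl u x) (c := curl (curl u) x) (hM x)).1
  have hdfn0 : ∀ x, 0 ≤ dfn x := fun x => sub_nonneg.2 (hal1 x)
  have hpt : ∀ x, |⟪u x, cross (curl u x) (curl (curl u) x)⟫| ≤
      (M * ‖curl u x‖) * Real.sqrt (dfn x) := by
    intro x
    have h := (inner_cross_sq_le_direction (a := curl u x) (c := curl (curl u) x) (hM x)).2
    rw [← Real.sqrt_sq (abs_nonneg _), ← Real.sqrt_sq (by positivity : 0 ≤ M * ‖curl u x‖),
      ← Real.sqrt_mul (sq_nonneg _)]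
    refine Real.sqrt_le_sqrt ?_
    rw [sq_abs, mul_pow]
    exact h
  -- measurability / integrability
  have meas_al : Measurable al :=
    ((hu.continuous.inner cc).pow 2).measurable.div (hu.continuous.norm.pow 2).measurable
  have meas_dfn : Measurable dfn := (cc.norm.pow 2).measurable.sub meas_al
  have iW : Integrable (fun x => ‖curl (curl u) x‖ ^ 2) := integrable_norm_curl_curl_sq hu iA
  have ial : Integrable al := iW.mono' meas_al.aestronglyMeasurable (Eventually.of_forall fun x => by
    rw [Real.norm_of_nonneg (hal0 x)]; exact hal1 x)
  have idfn : Integrable dfn := iW.sub ial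
  have hD : ∫ x, dfn x = (∫ x, ‖curl (curl u) x‖ ^ 2) - ∫ x, al x := integral_sub iW ial
  have mω : MemLp (fun x => M * ‖curl u x‖) 2 volume := (memLp_two_norm_curl hu iZ).const_mul M
  have msq : MemLp (fun x => Real.sqrt (dfn x)) 2 volume := by
    refine (memLp_two_iff_integrable_sq meas_dfn.sqrt.aestronglyMeasurable).2 ?_
    exact idfn.congr (Eventually.of_forall fun x => (Real.sq_sqrt (hdfn0 x)).symm)
  have iI : Integrable (fun x => ⟪u x, cross (curl u x) (curl (curl u) x)⟫) :=
    integrable_inner_cross_curl hu hM iZ iA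
  -- Cauchy–Schwarz chain
  have h1 : |∫ x, ⟪u x, cross (curl u x) (curl (curl u) x)⟫| ≤
      ∫ x, (M * ‖curl u x‖) * Real.sqrt (dfn x) :=
    (abs_integral_le_integral_abs).trans (integral_mono iI.abs (mω.integrable_mul msq) hpt)
  have h2 : ∫ x, (M * ‖curl u x‖) * Real.sqrt (dfn x) ≤
      Real.sqrt (∫ x, (M * ‖curl u x‖) ^ 2) * Real.sqrt (∫ x, Real.sqrt (dfn x) ^ 2) :=
    integral_mul_le_sqrt_mul_sqrt_of_memLp mω msq
  have hsq : ∫ x, Real.sqrt (dfn x) ^ 2 = ∫ x, dfn x :=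
    integral_congr_ae (Eventually.of_forall fun x => Real.sq_sqrt (hdfn0 x))
  have hMZ : ∫ x, (M * ‖curl u x‖) ^ 2 = M ^ 2 * ∫ x, ‖curl u x‖ ^ 2 := by
    simp_rw [mul_pow]
    exact integral_const_mul _ _
  rw [hsq, hMZ] at h2
  have hZ0 : 0 ≤ M ^ 2 * ∫ x, ‖curl u x‖ ^ 2 := mul_nonneg (sq_nonneg _) (integral_nonneg fun x => sq_nonneg _)
  have hD0 : 0 ≤ ∫ x, dfn x := integral_nonneg hdfn0
  rw [← hD]
  calc (∫ x, ⟪u x, cross (curl u x) (curl (curl u) x)⟫) ^ 2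
      = |∫ x, ⟪u x, cross (curl u x) (curl (curl u) x)⟫| ^ 2 := (sq_abs _).symm
    _ ≤ (Real.sqrt (M ^ 2 * ∫ x, ‖curl u x‖ ^ 2) * Real.sqrt (∫ x, dfn x)) ^ 2 :=
        pow_le_pow_left₀ (abs_nonneg _) (h1.trans h2) 2
    _ = M ^ 2 * (∫ x, ‖curl u x‖ ^ 2) * ∫ x, dfn x := by
        rw [mul_pow, Real.sq_sqrt hZ0, Real.sq_sqrt hD0]

end Class

end Summit.NavierStokesRegularity.NavierStokesRegularity.Theorems.DepletionLadder

end
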